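import Summits.Ventures.HSemireg.WedgeWeilCarrierPurity
import Summits.Ventures.HSemireg.ContractionRankPointPairBox
import Summits.Ventures.HSemireg.ContractionSpanKunnethFactors
import HarnessLib

/-!
# Venture HSemireg — `contractionRank` of a WEIL-FRAME class with TWO-EXPONENTIAL h-part on the REAL carriers at `g = 4`:
# `r(A, κ) = 18` on the purity locus `ab = c₁c₂(λ−μ)⁴`, `= 20` off it (FORMULA-N PART B §L.5 / STRUCTURE.md C16, n = 2)

HONEST FRAMING. The end-to-end form of the Weil-frame PURITY-LOCUS LAW (th-7, theory/FORMULA-N-th7.md PART B §L.5;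
kernel files `WedgeBoxPurity.lean` / `WedgeWeilPurity.lean` (th-7) and `WedgeWeilCarrierPurity.lean` (p6)) on the carriers of
`PerfectComplexRankDoor.lean`, in the frame and with the by-value binders of p4's `ContractionRankWeil.lean`:
`V = H¹(A(ℂ); ℂ)` (`complexBetti A.X 1`), `L = H^{0,1}` (the tree's `hodgeZeroOne`), `Θ = L^⊥`; an ADAPTED BASIS `bV` of `H¹(A)`
indexed by `Fin (4 + 4)` whose first `4` vectors span `H^{0,1}(A)` (`hL`), and the identity
`totalExteriorClass A κ = Ecl bV q 4 + a·w₊ + b·w₋` (`hx`) with `q_j = c₁λ^j + c₂μ^j` BY VALUE (`w₊ = wUp bV 2`, `w₋ = wLow bV 2`).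
THE WEIL FRAME IS AN INPUT: on a Weil-type abelian fourfold these are the data of FORMULA-N PART B §L (the `K`-eigenspace
splitting of `H¹`, the polarisation `Θ`, the Weil plane `⟨w₊, w₋⟩`, a `K`-secant-type h-part `c₁e^{λΘ} + c₂e^{μΘ}`); the tree has
no structure theory deriving them for an explicit variety — a consumer supplies them, exactly as for `ContractionRankWeil.lean`.
For th-7's wedge-model parameters of the cell's T4a class `𝓔₀` (`c₁ = c₂ = −1`, `λ = 0`, `μ = −1`, model coefficients with
`ab = 1`; at `n = 2` the carrier coefficients are `(−a, −b)` — `WedgeWeilCarrierPurity.finrank_S_weil_eq_vP` — with the same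
product) the locus condition `ab = c₁c₂(λ−μ)⁴ = 1` holds and the number is `18`; WHICH `(q; a, b)` a given sheaf has is the
by-value input `hx`, not derived here.  Nothing here is a claim about any explicit variety; nothing here says that HC / HC_CM / HC_AV holds.
Everything PROVED; no named fact.
-/

noncomputable section

open Module
open Literature.AlgebraicGeometry.Motives Literature.AlgebraicGeometry.HodgeTheory

namespace Summit.Ventures.HSemireg

variable {A : AbelianVariety ℂ}

open Classical in
/-- **PURITY LOCUS on the real carriers (Weil type `(2, 2)`, `g = 4`):** if `H¹(A)` has an adapted basis `bV` (indexed by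
`Fin (4 + 4)`) whose first half spans `H^{0,1}(A)`, and the total class of `κ` in `Λ H¹(A)` is
`Ecl bV q 4 + a·w₊ + b·w₋` with `q_j = c₁λ^j + c₂μ^j`, `λ ≠ μ`, `c₁ c₂ a b ≠ 0`, then
`contractionRank A κ = 18` if `ab = c₁c₂(λ − μ)⁴` and `= 20` otherwise (the `n = 2` row `18 ∣ 20` of FORMULA-N PART B §L.5;
`18` = the cell's g = 4 anchor in the Weil frame). [cite: BuchweitzFlenner2008HH, Prop. 6.4.4] [cite: MumfordAV1970, §1 (4) and §4 (iii)] -/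
theorem contractionRank_weil_purity_two (hA : IsSmoothProjective A.dim A.X) (κ : ∀ p : ℕ, complexBetti A.X (2 * p))
    (bV : Basis (Fin (2 + 2 + (2 + 2))) ℂ (complexBetti A.X 1)) (hL : hodgeZeroOne hA = WedgeBridge.Lsp bV)
    {c₁ c₂ lam mu a b : ℂ} (h1 : c₁ ≠ 0) (h2 : c₂ ≠ 0) (hlm : lam ≠ mu) (ha : a ≠ 0) (hb : b ≠ 0)
    (hx : totalExteriorClass A κ =
      WedgeBridge.Ecl bV (fun j => c₁ * lam ^ j + c₂ * mu ^ j) (2 + 2) + a • WeilCarrier.wUp bV 2 +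
        b • WeilCarrier.wLow bV 2) :
    contractionRank A κ = ((if a * b = c₁ * c₂ * (lam - mu) ^ 4 then 18 else 20 : ℕ) : Cardinal) := by
  haveI : Module.Finite ℂ (complexBetti A.X 1) := abelianVarietyCohomologyExteriorH1_holds.finite_one A
  rw [contractionRank_eq_finrank_span, hx, vectorFieldSet_eq A hA rfl, ← coe_hodgeZeroOne_eq_hodgeZeroOneSet A hA rfl,
    hL, ← ContractionSpan.coe_dualAnnihilator_eq, WeilCarrier.finrank_contractionSpan_weil_purity_two bV h1 h2 hlm ha hb]

open Classical in
/-- **the same ON the locus, as the bare number:** `ab = c₁c₂(λ−μ)⁴` ⟹ `contractionRank A κ = 18` (e.g. th-7's parameters of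
the T4a class: `c₁ = c₂ = −1`, `λ = 0`, `μ = −1`, `ab = 1`). [cite: BuchweitzFlenner2008HH, Prop. 6.4.4] -/
theorem contractionRank_weil_purity_two_on (hA : IsSmoothProjective A.dim A.X) (κ : ∀ p : ℕ, complexBetti A.X (2 * p))
    (bV : Basis (Fin (2 + 2 + (2 + 2))) ℂ (complexBetti A.X 1)) (hL : hodgeZeroOne hA = WedgeBridge.Lsp bV)
    {c₁ c₂ lam mu a b : ℂ} (h1 : c₁ ≠ 0) (h2 : c₂ ≠ 0) (hlm : lam ≠ mu) (ha : a ≠ 0) (hb : b ≠ 0)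
    (hloc : a * b = c₁ * c₂ * (lam - mu) ^ 4)
    (hx : totalExteriorClass A κ =
      WedgeBridge.Ecl bV (fun j => c₁ * lam ^ j + c₂ * mu ^ j) (2 + 2) + a • WeilCarrier.wUp bV 2 +
        b • WeilCarrier.wLow bV 2) :
    contractionRank A κ = 18 := by
  rw [contractionRank_weil_purity_two hA κ bV hL h1 h2 hlm ha hb hx, if_pos hloc]
  norm_num

/- the T4a parameters instantiate the locus: `c₁ = c₂ = −1`, `λ = 0`, `μ = −1`, `a = b = 1` (or `a = b = −1`). -/
example : (1 : ℂ) * 1 = (-1) * (-1) * ((0 : ℂ) - (-1)) ^ 4 := by norm_num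
example : (-1 : ℂ) * (-1) = (-1) * (-1) * ((0 : ℂ) - (-1)) ^ 4 := by norm_num

open Classical in
/-- **… and OFF the locus:** `ab ≠ c₁c₂(λ−μ)⁴` ⟹ `contractionRank A κ = 20`. [cite: BuchweitzFlenner2008HH, Prop. 6.4.4] -/
theorem contractionRank_weil_purity_two_off (hA : IsSmoothProjective A.dim A.X) (κ : ∀ p : ℕ, complexBetti A.X (2 * p))
    (bV : Basis (Fin (2 + 2 + (2 + 2))) ℂ (complexBetti A.X 1)) (hL : hodgeZeroOne hA = WedgeBridge.Lsp bV)
    {c₁ c₂ lam mu a b : ℂ} (h1 : c₁ ≠ 0) (h2 : c₂ ≠ 0) (hlm : lam ≠ mu) (ha : a ≠ 0) (hb : b ≠ 0)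
    (hloc : a * b ≠ c₁ * c₂ * (lam - mu) ^ 4)
    (hx : totalExteriorClass A κ =
      WedgeBridge.Ecl bV (fun j => c₁ * lam ^ j + c₂ * mu ^ j) (2 + 2) + a • WeilCarrier.wUp bV 2 +
        b • WeilCarrier.wLow bV 2) :
    contractionRank A κ = 20 := by
  rw [contractionRank_weil_purity_two hA κ bV hL h1 h2 hlm ha hb hx, if_neg hloc]
  norm_num

end Summit.Ventures.HSemireg

end
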